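import Literature.NumberTheory.EllipticCurves.KernelReductionTateFormTorsionProofs
import Literature.NumberTheory.EllipticCurves.SameJIsomorphismGaloisProofs
import Literature.NumberTheory.EllipticCurves.KernelReductionInertiaProofs
import Literature.NumberTheory.EllipticCurves.InertiaAboveEllCyclotomicProofs
import Literature.NumberTheory.EllipticCurves.PotentiallyMultiplicativeRamifiedTorsion
import HarnessLib

/-!
# `(τ - 1) E[ℓᵐ]` is small at a potentially multiplicative place above `ℓ`

`Proofs` file (theorems only, no definitions, no named facts), topic `NumberTheory/EllipticCurves`.
The multiplicative counterpart of `KernelReductionInertiaProofs` (ordinary good place above `ℓ`).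

Let `E` be an elliptic curve over a number field `K`, `ℓ` an odd prime and `v ∣ ℓ` a finite
place with `ord_v(j(E)) < 0` (`1 < v.valuation K (j E)`: potentially multiplicative reduction).
Then **there is `τ ∈ Γ_K` with `χ_ℓ(τ) ≠ 1` such that `#((τ - 1) E[ℓᵐ]) ≤ ℓᵐ` for every `m`**
(`WeierstrassCurve.exists_cyclotomicCharacter_ne_one_card_map_smul_sub_le_of_one_lt_valuation_j`).
This is the finite-level content of Serre, *Abelian ℓ-adic representations* (1968), IV, A.1.2–
A.1.3 (at a place of potentially multiplicative reduction the Tate module is, over an open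
subgroup of the decomposition group, an extension of `ℤ_ℓ` by `ℤ_ℓ(1)`), obtained without the
Tate curve:

* transport `E(K̄) ↪ E(K̄_v) ≃ T(K̄_v)` to the **Tate form of invariant `j(E)`** over `K_v`
  (`tateFormOfJ`, `isTateForm_tateFormOfJ_of_one_lt`: `y² + xy = x³ - 36x/(j - 1728) - 1/(j - 1728)`
  is in Tate form for `|·|_v` when `|j|_v > 1`) by the isomorphism of curves with the same `j`
  (`exists_addEquiv_baseChange_of_j_eq_map_algEquiv_sq`, `SameJIsomorphismGaloisProofs`), which
  intertwines the *squares* of the elements of `Γ_{K_v}` (it is a quadratic twist);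
* on the Tate form every isometry moves the `ℓ`-power torsion into the kernel of reduction
  (`TateForm.one_lt_valuation_of_map_sub_eq_some_of_zsmul_eq_zero`,
  `KernelReductionTateFormTorsionProofs`), whose finite subgroups killed by `ℓᵐ` have `≤ ℓᵐ`
  elements (`TateForm.card_addSubgroup_le_pow`: the Hasse invariant of a Tate form is a unit);
* `τ = τ₀²` for an inertia element `τ₀ ∈ I_𝔓`, `𝔓 ∣ v`, none of whose powers has trivial
  cyclotomic character (`exists_mem_inertia_forall_cyclotomicCharacter_pow_ne_one`, sharpening
  `exists_mem_inertia_cyclotomicCharacter_ne_one` of `InertiaAboveEllCyclotomicProofs`), lifted to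
  `Γ_{K_v}` along an embedding `K̄ → K̄_v` cutting out `𝔓` (`exists_mem_inertia_apply_eq_holds`).

## References

* [SerreAbelianLadic1968] J.-P. Serre, *Abelian ℓ-adic representations and elliptic curves*
  (1968), Ch. IV, A.1.2–A.1.3 and §2.2.
* [SilvermanAEC2009] J. H. Silverman, *The Arithmetic of Elliptic Curves*, 2nd ed., VII.2.1,
  VII.5.5, X.5.4.
* [SilvermanATAEC1994] J. H. Silverman, *Advanced Topics*, V.3–V.5.
-/

noncomputable section

open scoped Classical NNReal NumberField Pointwise
open NumberField IsDedekindDomain Field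

universe u

/-! ## Inertia elements above `ℓ` no power of which has trivial cyclotomic character -/

namespace Literature.NumberTheory.GaloisRepresentations

variable {K : Type u} [Field K] [NumberField K] (ℓ : ℕ) [hℓ : Fact ℓ.Prime]

/-- **Some `τ ∈ I_𝔓`, `𝔓 ∣ v ∣ ℓ`, has `χ_ℓ(τ)ⁱ ≠ 1` for all `i ≥ 1`** (the element of
`exists_mem_inertia_cyclotomicCharacter_ne_one` has `χ_ℓ(τ) = (1 + ℓ)ʲ` with `j ≥ 1`).
[cite: SerreAbelianLadic1968, I.1.2] [cite: NeukirchANT1999, Ch. II (7.13)] -/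
theorem exists_mem_inertia_forall_cyclotomicCharacter_pow_ne_one {v : HeightOneSpectrum (𝓞 K)}
    (hℓv : (ℓ : 𝓞 K) ∈ v.asIdeal) {𝔓 : Ideal (absIntegers (𝓞 K) K)} (h𝔓 : 𝔓 ∈ v.primesAbove) :
    ∃ τ ∈ 𝔓.inertia (absoluteGaloisGroup K),
      ∀ i : ℕ, 0 < i → GaloisRep.cyclotomicCharacter K ℓ τ ^ i ≠ 1 := by
  obtain ⟨u, hu, hvu⟩ := exists_heightOneSpectrum_rat_under hℓ.out hℓv
  have h𝔓' : 𝔓.comap (absIntegersMap ℚ K) ∈ u.primesAbove :=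
    comap_absIntegersMap_mem_primesAbove hu h𝔓
  obtain ⟨w, hw⟩ := exists_unit_pow_ne_one ℓ
  obtain ⟨τ', hτ'I, hτ'χ⟩ :=
    Literature.NumberTheory.EllipticCurves.exists_mem_inertia_cyclotomicCharacter_eq ℓ hvu h𝔓' w
  obtain ⟨j, hj, τ, hτ⟩ := exists_pow_mem_range_absGaloisRestrict ℚ K τ'
  have hτ' : absGaloisRestrict ℚ K τ = τ' ^ j := hτ
  refine ⟨τ, ?_, fun i hi ↦ ?_⟩
  · rw [← comap_inertia_comap_absIntegersMap ℚ K 𝔓, Subgroup.mem_comap]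
    change absGaloisRestrict ℚ K τ ∈ _
    rw [hτ']
    exact Subgroup.pow_mem _ hτ'I j
  · rw [cyclotomicCharacter_eq_cyclotomicCharacter_rat_absGaloisRestrict K ℓ τ, hτ', map_pow, hτ'χ,
      ← pow_mul]
    exact hw (j * i) (Nat.mul_pos hj hi)

end Literature.NumberTheory.GaloisRepresentations

/-! ## `|x|_v > 1` in `K̄_v` when `ord_v(x) < 0` -/

namespace IsDedekindDomain.HeightOneSpectrum

open Literature.NumberTheory.EllipticCurves Literature.NumberTheory.GaloisRepresentations Field

variable {K : Type u} [Field K] [NumberField K] {v : HeightOneSpectrum (𝓞 K)}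
  {w : Valuation (AlgebraicClosure (v.adicCompletion K)) ℝ≥0}
  (hw : ∀ x, (w x : ℝ) = spectralNorm (v.adicCompletion K) (AlgebraicClosure (v.adicCompletion K)) x)
include hw

/-- For `x ∈ K` with `v.valuation K x > 1` (i.e. `ord_v(x) < 0`), `|x|_v > 1` in `K̄_v`.
[folklore] -/
theorem one_lt_spectralValuation_algebraMap_of_one_lt_valuation {x : K}
    (hx : 1 < v.valuation K x) :
    1 < w (algebraMap K (AlgebraicClosure (v.adicCompletion K)) x) := by
  rw [IsScalarTower.algebraMap_apply K (v.adicCompletion K) (AlgebraicClosure (v.adicCompletion K)),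
    ← NNReal.coe_lt_coe, coe_spectralValuation_algebraMap hw, NNReal.coe_one,
    Valued.toNormedField.one_lt_norm_iff]
  change 1 < Valued.v ((x : K) : v.adicCompletion K)
  rw [valuedAdicCompletion_eq_valuation']
  exact hx

end IsDedekindDomain.HeightOneSpectrum

/-! ## Number fields: `(τ - 1) E[ℓᵐ]` at a potentially multiplicative place above `ℓ` -/

namespace WeierstrassCurve

open Literature.NumberTheory.EllipticCurves Literature.NumberTheory.GaloisRepresentations Field
  IsDedekindDomain.HeightOneSpectrum

variable {K : Type u} [Field K] [NumberField K] (W : WeierstrassCurve K)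

/-- **At a potentially multiplicative place above `ℓ` (`ℓ` odd) there is `τ ∈ Γ_K` with
`χ_ℓ(τ) ≠ 1` and `#((τ - 1) E[ℓᵐ]) ≤ ℓᵐ` for all `m`.**  See the module docstring: `τ = τ₀²`
for an inertia element `τ₀` above `v` with `χ_ℓ(τ₀)² ≠ 1`; the bound is the kernel-of-reduction
count on the Tate form of invariant `j(E)` over `K_v`, to which `E(K̄)` maps by an additive
injection intertwining `τ` with an isometry of `K̄_v`.
[cite: SerreAbelianLadic1968, IV A.1.2–A.1.3] [cite: SilvermanAEC2009, X.5.4 and VII.5.5] -/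
theorem exists_cyclotomicCharacter_ne_one_card_map_smul_sub_le_of_one_lt_valuation_j
    [W.IsElliptic] {v : HeightOneSpectrum (𝓞 K)} {ℓ : ℕ} [hℓ : Fact ℓ.Prime] (hℓ2 : ℓ ≠ 2)
    (hℓv : (ℓ : 𝓞 K) ∈ v.asIdeal) (hj : 1 < v.valuation K W.j) :
    ∃ τ : absoluteGaloisGroup K, GaloisRep.cyclotomicCharacter K ℓ τ ≠ 1 ∧
      ∀ m : ℕ, Nat.card ((geomTorsion W ((ℓ ^ m : ℕ) : ℤ)).map
        (DistribSMul.toAddMonoidHom (geomPoints W) τ - AddMonoidHom.id (geomPoints W))) ≤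
          ℓ ^ m := by
  obtain ⟨𝔐, h𝔐⟩ := v.localPrimesAbove_nonempty
  set ι : AlgebraicClosure K →ₐ[K] AlgebraicClosure (v.adicCompletion K) :=
    closureEmb (K := K) (v.adicCompletion K) with hι
  have h𝔓 : v.primeBelow ι 𝔐 ∈ v.primesAbove := HeightOneSpectrum.primeBelow_mem_primesAbove h𝔐
  -- an inertia element `τ₀` above `v` with `χ(τ₀)² ≠ 1`, and a local lift `σ₀`
  obtain ⟨τ₀, hτ₀I, hτ₀χ⟩ :=
    exists_mem_inertia_forall_cyclotomicCharacter_pow_ne_one ℓ hℓv h𝔓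
  obtain ⟨σ₀, -, hσ₀⟩ :=
    IsDedekindDomain.HeightOneSpectrum.exists_mem_inertia_apply_eq_holds v ι h𝔐 hτ₀I
  have hres₀ : resGalOfEmb ι σ₀ = τ₀ := resGalOfEmb_eq_of_apply_eq ι hσ₀
  set σ := σ₀ * σ₀ with hσdef
  set τ := resGalOfEmb ι σ with hτdef
  have hτ : τ = τ₀ * τ₀ := by rw [hτdef, hσdef, map_mul, hres₀]
  refine ⟨τ, ?_, fun m ↦ ?_⟩
  · rw [hτ, map_mul, ← sq]
    exact hτ₀χ 2 two_pos
  -- notation and the Tate form of invariant `j` over `K_v`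
  obtain ⟨w, hw⟩ := v.exists_spectralValuation
  set E := v.adicCompletion K
  set L := AlgebraicClosure (v.adicCompletion K)
  have hjw : 1 < w (algebraMap K L W.j) :=
    one_lt_spectralValuation_algebraMap_of_one_lt_valuation hw hj
  obtain ⟨hj0, hj1728, hT, ha₆, -, -⟩ := W.isTateForm_tateFormOfJ_of_one_lt hjw
  set jv : E := algebraMap K E W.j with hjv
  haveI hTell : (tateFormOfJ jv).IsElliptic := isElliptic_tateFormOfJ hj0 hj1728
  haveI : CharZero E := charZero_of_injective_algebraMap (algebraMap K E).injective
  have hjW : (W.baseChange E).j = jv := W.map_j _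
  have hjE : (W.baseChange E).j = (tateFormOfJ jv).j := by
    rw [hjW, tateFormOfJ_j hj0 hj1728]
  have hjE0 : (W.baseChange E).j ≠ 0 := by rw [hjW]; exact hj0
  have hjE1728 : (W.baseChange E).j ≠ 1728 := by rw [hjW]; exact hj1728
  -- the twisting isomorphism, intertwining squares
  obtain ⟨e, he⟩ := exists_addEquiv_baseChange_of_j_eq_map_algEquiv_sq (W.baseChange E)
    (tateFormOfJ jv) L hjE hjE0 hjE1728
  -- integrality of the Tate form
  haveI hint : ((tateFormOfJ jv).baseChange L).IsIntegral w.integer := by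
    refine isIntegral_integer_of_val_le_one ?_ ?_ ?_ (hT.w_a₄_le.trans hT.w_a₆_lt.le)
      hT.w_a₆_lt.le
    · rw [hT.a₁, map_one]
    · rw [hT.a₂, map_zero]; exact zero_le_one
    · rw [hT.a₃, map_zero]; exact zero_le_one
  set σE : L ≃ₐ[E] L := absoluteGaloisGroup.toAlgEquiv _ σ with hσE
  have hσE' : σE = absoluteGaloisGroup.toAlgEquiv _ σ₀ * absoluteGaloisGroup.toAlgEquiv _ σ₀ := by
    rw [hσE, hσdef, map_mul]
  have hσ₁ : ∀ z : L, w (σE z) = w z := fun z ↦ spectralValuation_smul hw σ z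
  -- the transport `Ψ : E(K̄) → T₀(K̄_v)`
  let Φ : localPoints W E ≃+ ((tateFormOfJ jv).baseChange L).toAffine.Point :=
    (Affine.Point.congrEquiv (baseChange_baseChange_adicCompletion W v).symm).trans e
  have hΦ : ∀ Q : localPoints W E, Φ (σ • Q) = Affine.Point.map (σE : L →ₐ[E] L) (Φ Q) := by
    intro Q
    change e (Affine.Point.congrEquiv (baseChange_baseChange_adicCompletion W v).symm (σ • Q)) =
      Affine.Point.map (σE : L →ₐ[E] L)
        (e (Affine.Point.congrEquiv (baseChange_baseChange_adicCompletion W v).symm Q))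
    rw [congrEquiv_smul, ← hσE, hσE']
    exact he _ _
  set Ψ : geomPoints W →+ ((tateFormOfJ jv).baseChange L).toAffine.Point :=
    Φ.toAddMonoidHom.comp (pointsMapOfEmb W ι) with hΨ
  have hΨinj : Function.Injective Ψ := Φ.injective.comp (pointsMapOfEmb_injective W ι)
  have hΨτ : ∀ P : geomPoints W, Ψ (τ • P) = Affine.Point.map (σE : L →ₐ[E] L) (Ψ P) := by
    intro P
    rw [hΨ, AddMonoidHom.coe_comp, Function.comp_apply, hτdef, pointsMapOfEmb_smul W ι σ P]
    exact hΦ _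
  -- the subgroup `(τ - 1) E[ℓᵐ]` and its image `G` in `T₀(K̄_v)`
  set f : geomPoints W →+ geomPoints W :=
    DistribSMul.toAddMonoidHom (geomPoints W) τ - AddMonoidHom.id (geomPoints W) with hf
  have hfapply : ∀ P, f P = τ • P - P := fun P ↦ rfl
  set H := (geomTorsion W ((ℓ ^ m : ℕ) : ℤ)).map f with hH
  have hℓm0 : ((ℓ ^ m : ℕ) : ℤ) ≠ 0 := by exact_mod_cast pow_ne_zero m hℓ.out.ne_zero
  haveI : Finite (geomTorsion W ((ℓ ^ m : ℕ) : ℤ)) :=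
    finite_torsionPoints_holds W (AlgebraicClosure K) hℓm0
  have hHfin : (H : Set (geomPoints W)).Finite := by
    rw [hH, AddSubgroup.coe_map]
    exact (Set.toFinite _).image f
  haveI : Finite H := hHfin.to_subtype
  set G := H.map Ψ with hG
  have hGfin : (G : Set ((tateFormOfJ jv).baseChange L).toAffine.Point).Finite := by
    rw [hG, AddSubgroup.coe_map]
    exact hHfin.image Ψ
  haveI : Finite G := hGfin.to_subtype
  have hcard : Nat.card H = Nat.card G := Nat.card_congr (H.equivMapOfInjective Ψ hΨinj).toEquiv
  rw [hcard]
  have hℓL : (ℓ : L) ≠ 0 := by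
    rw [← map_natCast (algebraMap K L) ℓ]
    exact (map_ne_zero_iff _ (algebraMap K L).injective).mpr (Nat.cast_ne_zero.mpr hℓ.out.ne_zero)
  have hℓw : w (ℓ : L) < 1 := spectralValuation_natCast_lt_one hw hℓv
  refine TateForm.card_addSubgroup_le_pow (tateFormOfJ jv) hT hℓ2 hℓw hℓL m G ?_ ?_
  · -- the affine points of `G` lie in `E₁`
    intro x y h hmem
    obtain ⟨Q, hQ, hQeq⟩ := AddSubgroup.mem_map.mp hmem
    obtain ⟨P, hP, rfl⟩ := AddSubgroup.mem_map.mp hQ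
    have hP0 : ((ℓ ^ m : ℕ) : ℤ) • P = 0 := (Submodule.mem_torsionBy_iff _ P).mp hP
    have hΨP0 : ((ℓ ^ m : ℕ) : ℤ) • Ψ P = 0 := by rw [← map_zsmul, hP0, map_zero]
    rw [hfapply, map_sub, hΨτ] at hQeq
    exact TateForm.one_lt_valuation_of_map_sub_eq_some_of_zsmul_eq_zero (tateFormOfJ jv) hT ha₆
      hℓ2 hℓw σE hσ₁ (Ψ P) hΨP0 hQeq
  · -- `G` is killed by `ℓᵐ`
    intro Q hmem
    obtain ⟨Q', hQ', rfl⟩ := AddSubgroup.mem_map.mp hmem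
    obtain ⟨P, hP, rfl⟩ := AddSubgroup.mem_map.mp hQ'
    have hP0 : ((ℓ ^ m : ℕ) : ℤ) • P = 0 := (Submodule.mem_torsionBy_iff _ P).mp hP
    rw [← map_zsmul Ψ, ← map_zsmul f, hP0, map_zero, map_zero]

end WeierstrassCurve

end
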